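import Mathlib
import HarnessLib
import Summits.Ventures.LatticeQCDFlow.Exactness.SphereLatticeSolidHarmonics
import Summits.Ventures.LatticeQCDFlow.Exactness.SphereLuscherSeriesSolver
import Summits.Ventures.LatticeQCDFlow.Exactness.LatticeSiteLocality

/-!
# The spectrum of Lüscher's operator on the lattice polynomials of degree `≤ N` is EXACTLY the label set: every label `Σ_n c_n(c_n + d − 2)` is an eigenvalue (products of one-site solid harmonics)

HONEST FRAMING: exact (Metropolis-corrected) sampling algorithms for lattice gauge theory;
figures of merit are autocorrelation/cost numbers at stated couplings and volumes; no
continuum-physics claim.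

Venture `LatticeQCDFlow` (cell pub-lqcd), topic `Exactness`; FANOUT row 7 (`s0-cpn-null`: the
S0-D1 rung — 2D CP⁹, Lüscher's LO trivializing map inside HMC, Engel–Schaefer 2011).  NEW WORK of
the cell over the tree's `Exactness/SphereLatticeSolidHarmonics.lean` (one-site solid harmonics
`R_N`, `𝔏 R_N = N(N+d−2) R_N`), `Exactness/LatticeSiteLocality.lean` (`sdepOn`: site operators
vanish off the support), `Exactness/LatticeSitePolynomialOperator.lean` (`polyLap`, `eigLabel`,
`siteCount`), `Exactness/SphereLuscherSeriesSolver.lean` (`labelSet`) and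
`Exactness/SphereLatticeLaplacianSpectrum.lean` (every eigenvalue is a label); nothing is cited as
a fact.  Printed counterpart, NAMED ONLY: M. Lüscher, Commun. Math. Phys. 293 (2010) 899, §3.3;
Engel–Schaefer, Comput. Phys. Commun. 182 (2011) 2107, §3.  Classical background: products of
spherical harmonics at distinct sites are joint eigenfunctions of the site Laplace–Beltrami
operators; here obtained in the ambient site calculus.

## Content (`E` finite-dimensional, `d = dim E ≥ 2`; `Λ` finite; frame indices `i₀ ≠ i₁`)

* `siteDeriv_mul_of_not_mem`, `siteEuler_mul_of_not_mem`, `siteFlatLap_mul_of_not_mem`,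
  **`ambSiteLap_mul_of_not_mem`** — LEIBNIZ WITHOUT CROSS TERM: if `G` does not depend on site `k`
  then `ambSiteLap k (F·G) = (ambSiteLap k F)·G`; `reZpow_mem_sdepOn` (`R_N^{(n)}` depends on site
  `n` only).
* `harmonicProd c s = ∏_{n ∈ s} R_{c n}^{(n)}` — PRODUCTS OF ONE-SITE SOLID HARMONICS over a finite
  set of sites with prescribed degrees `c`; in `polyS (Σ_{n∈s} c n)`, supported in `s`, equal to `1`
  at `x ≡ b i₀`; **`sum_ambSiteLap_harmonicProd`**: `𝔏 (∏ R) = (Σ_{n∈s} c_n(c_n + d − 2)) · ∏ R`.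
* **`hasEigenvalue_polyLap_of_mem_labelSet`** — EVERY LABEL IS AN EIGENVALUE of `polyLap N`
  (realise the site counts of the labelling monomial by `harmonicProd` over all sites);
  **`hasEigenvalue_polyLap_iff_mem_labelSet`** — THE SPECTRUM OF `𝔏₀` ON `polyS N` IS EXACTLY
  `labelSet N` (`d ≥ 2`); **`exists_sphere_eigenfunction_of_mem_labelSet`** — on the product of unit
  spheres every label has a lattice-polynomial eigenfunction not vanishing identically.

NOT CLAIMED: multiplicities / dimensions of the eigenspaces; anything about flows or numbers.
-/

noncomputable section

namespace Summit.Ventures.LatticeQCDFlow.Exactness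

open Function Set Metric
open scoped RealInnerProductSpace ContDiff

variable {Λ : Type*} {E : Type*} [NormedAddCommGroup E] [InnerProductSpace ℝ E]
  [FiniteDimensional ℝ E]
variable [Fintype Λ] [DecidableEq Λ]

/-! ## §1 Leibniz without cross term for a factor not depending on the site -/

section Leibniz

omit [FiniteDimensional ℝ E] in
/-- `D_{k,v}(F·G) = (D_{k,v} F)·G` when `G` does not depend on site `k`. -/
theorem siteDeriv_mul_of_not_mem {A : Set Λ} {F G : (Λ → E) → ℝ} (hF : ContDiff ℝ ∞ F)
    (hG : ContDiff ℝ ∞ G) (hGA : G ∈ sdepOn A) {k : Λ} (hk : k ∉ A) (v : E) :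
    siteDeriv k v (F * G) = siteDeriv k v F * G := by
  funext x
  rw [siteDeriv_mul v (differentiableAt_section hF x k _) (differentiableAt_section hG x k _),
    congrFun (siteDeriv_eq_zero_of_not_mem hGA hk v) x]
  simp

omit [FiniteDimensional ℝ E] in
/-- `E_k(F·G) = (E_k F)·G` when `G` does not depend on site `k`. -/
theorem siteEuler_mul_of_not_mem {A : Set Λ} {F G : (Λ → E) → ℝ} (hF : ContDiff ℝ ∞ F)
    (hG : ContDiff ℝ ∞ G) (hGA : G ∈ sdepOn A) {k : Λ} (hk : k ∉ A) :
    siteEuler k (F * G) = siteEuler k F * G := by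
  funext x
  rw [siteEuler_mul (differentiableAt_section hF x k _) (differentiableAt_section hG x k _),
    congrFun (siteEuler_eq_zero_of_not_mem hGA hk) x]
  simp

/-- `siteFlatLap k (F·G) = (siteFlatLap k F)·G` when `G` does not depend on site `k`. -/
theorem siteFlatLap_mul_of_not_mem {A : Set Λ} {F G : (Λ → E) → ℝ} (hF : ContDiff ℝ ∞ F)
    (hG : ContDiff ℝ ∞ G) (hGA : G ∈ sdepOn A) {k : Λ} (hk : k ∉ A) (x : Λ → E) :
    siteFlatLap k (F * G) x = siteFlatLap k F x * G x := by
  unfold siteFlatLap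
  rw [Finset.sum_mul]
  refine Finset.sum_congr rfl fun i _ => ?_
  rw [siteDeriv_mul_of_not_mem hF hG hGA hk, siteDeriv_mul_of_not_mem (contDiff_siteDeriv hF k _)
    hG hGA hk]
  rfl

/-- **`ambSiteLap k (F·G) = (ambSiteLap k F)·G` when `G` does not depend on site `k`.** -/
theorem ambSiteLap_mul_of_not_mem {A : Set Λ} {F G : (Λ → E) → ℝ} (hF : ContDiff ℝ ∞ F)
    (hG : ContDiff ℝ ∞ G) (hGA : G ∈ sdepOn A) {k : Λ} (hk : k ∉ A) (x : Λ → E) :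
    ambSiteLap k (F * G) x = ambSiteLap k F x * G x := by
  have h1 := siteFlatLap_mul_of_not_mem hF hG hGA hk x
  have h2 : siteEuler k (F * G) x = siteEuler k F x * G x := by
    rw [siteEuler_mul_of_not_mem hF hG hGA hk]; rfl
  have h3 : siteEuler k (siteEuler k (F * G)) x = siteEuler k (siteEuler k F) x * G x := by
    rw [siteEuler_mul_of_not_mem hF hG hGA hk, siteEuler_mul_of_not_mem (contDiff_siteEuler hF k)
      hG hGA hk]; rfl
  simp only [ambSiteLap, h1, h2, h3]
  ring

/-- **Additivity over independent factors**: if `F` depends only on `A`, `G` only on `B`, and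
`A ∩ B = ∅`, then `ambSiteLap k (F·G) = (ambSiteLap k F)·G + F·(ambSiteLap k G)` for every `k`. -/
theorem ambSiteLap_mul_of_disjoint {A B : Set Λ} (hAB : Disjoint A B) {F G : (Λ → E) → ℝ}
    (hF : ContDiff ℝ ∞ F) (hG : ContDiff ℝ ∞ G) (hFA : F ∈ sdepOn A) (hGB : G ∈ sdepOn B) (k : Λ)
    (x : Λ → E) : ambSiteLap k (F * G) x = ambSiteLap k F x * G x + F x * ambSiteLap k G x := by
  by_cases hkB : k ∈ B
  · have hkA : k ∉ A := fun h => hAB.le_bot ⟨h, hkB⟩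
    rw [mul_comm F G, ambSiteLap_mul_of_not_mem hG hF hFA hkA,
      congrFun (ambSiteLap_eq_zero_of_not_mem hFA hkA) x]
    simp [mul_comm]
  · rw [ambSiteLap_mul_of_not_mem hF hG hGB hkB, congrFun (ambSiteLap_eq_zero_of_not_mem hGB hkB) x]
    simp

end Leibniz

/-! ## §2 Products of one-site solid harmonics -/

section Products

variable (i₀ i₁ : Fin (Module.finrank ℝ E))

omit [Fintype Λ] [DecidableEq Λ] in
/-- `R_N^{(n)}` and `I_N^{(n)}` depend on site `n` only. -/
theorem zpow_mem_sdepOn (n : Λ) : ∀ N : ℕ,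
    reZpow n i₀ i₁ N ∈ sdepOn ({n} : Set Λ) ∧ imZpow n i₀ i₁ N ∈ sdepOn ({n} : Set Λ)
  | 0 => ⟨const_mem_sdepOn _ 1, by rw [imZpow_zero]; exact const_mem_sdepOn _ 0⟩
  | N + 1 => by
      obtain ⟨hR, hI⟩ := zpow_mem_sdepOn n N
      rw [reZpow_succ, imZpow_succ]
      exact ⟨Submodule.sub_mem _ (mul_mem_sdepOn (scoord_mem_sdepOn rfl) hR)
          (mul_mem_sdepOn (scoord_mem_sdepOn rfl) hI),
        Submodule.add_mem _ (mul_mem_sdepOn (scoord_mem_sdepOn rfl) hI)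
          (mul_mem_sdepOn (scoord_mem_sdepOn rfl) hR)⟩

/-- **Products of one-site solid harmonics** with prescribed degrees `c n` over the sites of `s`. -/
def harmonicProd (c : Λ → ℕ) (s : Finset Λ) : (Λ → E) → ℝ := ∏ n ∈ s, reZpow n i₀ i₁ (c n)

omit [Fintype Λ] [DecidableEq Λ] in
/-- `harmonicProd c ∅ = 1`. -/
theorem harmonicProd_empty (c : Λ → ℕ) : harmonicProd i₀ i₁ c ∅ = fun _ : Λ → E => (1 : ℝ) := by
  funext x; simp [harmonicProd]

omit [Fintype Λ] in
/-- Inserting a site: `harmonicProd c (insert a s) = R_{c a}^{(a)} · harmonicProd c s`. -/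
theorem harmonicProd_insert (c : Λ → ℕ) {a : Λ} {s : Finset Λ} (ha : a ∉ s) :
    harmonicProd (E := E) i₀ i₁ c (insert a s) = reZpow a i₀ i₁ (c a) * harmonicProd i₀ i₁ c s := by
  unfold harmonicProd; rw [Finset.prod_insert ha]

omit [Fintype Λ] in
/-- **`harmonicProd c s ∈ polyS (Σ_{n∈s} c n)` and depends only on the sites of `s`.** -/
theorem harmonicProd_mem (c : Λ → ℕ) (s : Finset Λ) :
    harmonicProd (E := E) i₀ i₁ c s ∈ polyS Λ E (∑ n ∈ s, c n) ∧
      harmonicProd (E := E) i₀ i₁ c s ∈ sdepOn (↑s : Set Λ) := by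
  induction s using Finset.induction_on with
  | empty =>
      rw [harmonicProd_empty]
      exact ⟨by simpa using one_mem_polyS (Λ := Λ) (E := E) 0, const_mem_sdepOn _ 1⟩
  | insert a s ha ih =>
      rw [harmonicProd_insert i₀ i₁ c ha, Finset.sum_insert ha]
      refine ⟨mul_mem_polyS (reZpow_mem_polyS a i₀ i₁ (c a)) ih.1, ?_⟩
      rw [Finset.coe_insert]
      exact mul_mem_sdepOn (sdepOn_mono (Set.singleton_subset_iff.2 (Set.mem_insert _ _))
        (zpow_mem_sdepOn i₀ i₁ a (c a)).1) (sdepOn_mono (Set.subset_insert _ _) ih.2)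

/-- `harmonicProd` is smooth. -/
theorem contDiff_harmonicProd (c : Λ → ℕ) (s : Finset Λ) :
    ContDiff ℝ ∞ (harmonicProd (E := E) i₀ i₁ c s) :=
  contDiff_of_mem_polyS (harmonicProd_mem i₀ i₁ c s).1

omit [Fintype Λ] [DecidableEq Λ] in
/-- **`harmonicProd = 1` at the configuration `x ≡ b i₀`** (`i₀ ≠ i₁`). -/
theorem harmonicProd_frame (h : i₀ ≠ i₁) (c : Λ → ℕ) (s : Finset Λ) :
    harmonicProd i₀ i₁ c s (fun _ : Λ => stdOrthonormalBasis ℝ E i₀) = 1 := by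
  unfold harmonicProd
  rw [Finset.prod_apply]
  exact Finset.prod_eq_one fun n _ => (zpow_frame n i₀ i₁ h (c n)).1

/-- **`𝔏 (∏_{n∈s} R_{c n}^{(n)}) = (Σ_{n∈s} c_n (c_n + d − 2)) · ∏ R`** as ambient functions
(additivity of `ambSiteLap` over independent factors; `Σ_k ambSiteLap_k R_N = −N(N+d−2)R_N`). -/
theorem sum_ambSiteLap_harmonicProd (h : i₀ ≠ i₁) (c : Λ → ℕ) (s : Finset Λ) (x : Λ → E) :
    -∑ k, ambSiteLap k (harmonicProd i₀ i₁ c s) x =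
      (∑ n ∈ s, (c n : ℝ) * (c n + (Module.finrank ℝ E : ℝ) - 2)) * harmonicProd i₀ i₁ c s x := by
  induction s using Finset.induction_on generalizing x with
  | empty =>
      simp [harmonicProd_empty, ambSiteLap_const]
  | insert a s ha ih =>
      have hdis : Disjoint ({a} : Set Λ) (↑s : Set Λ) := by
        rw [Set.disjoint_singleton_left]; exact_mod_cast ha
      have hR := (contDiff_zpow a i₀ i₁ (c a)).1
      have hP := contDiff_harmonicProd (E := E) i₀ i₁ c s
      rw [harmonicProd_insert i₀ i₁ c ha, Finset.sum_insert ha]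
      simp_rw [ambSiteLap_mul_of_disjoint hdis hR hP (zpow_mem_sdepOn i₀ i₁ a (c a)).1
        (harmonicProd_mem i₀ i₁ c s).2]
      rw [Finset.sum_add_distrib, ← Finset.sum_mul, ← Finset.mul_sum, Pi.mul_apply, neg_add]
      have h1 := sum_ambSiteLap_reZpow a i₀ i₁ h (c a) x
      have h2 := ih x
      rw [neg_eq_iff_eq_neg] at h1 h2
      rw [h1, h2]
      ring

end Products

/-! ## §3 Every label is an eigenvalue -/

section Spectrum

omit [FiniteDimensional ℝ E] [Fintype Λ] in
/-- Site counts as natural numbers. -/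
theorem siteCount_eq_natCast {k : ℕ} (κs : Fin k → SiteCoord Λ E) (n : Λ) :
    siteCount n κs = ((Finset.univ.filter fun j => (κs j).1 = n).card : ℝ) := siteCount_eq_card n κs

omit [FiniteDimensional ℝ E] in
/-- The site counts add up to the degree (natural-number form of `sum_siteCount`). -/
theorem sum_card_filter_eq {k : ℕ} (κs : Fin k → SiteCoord Λ E) :
    ∑ n, (Finset.univ.filter fun j => (κs j).1 = n).card = k := by
  have h := sum_siteCount (Λ := Λ) (E := E) κs
  simp_rw [siteCount_eq_card] at h
  exact_mod_cast h

/-- **EVERY LABEL IS AN EIGENVALUE OF `𝔏₀` ON `polyS N`** (`d ≥ 2`): for a site monomial of degree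
`k ≤ N` with site counts `(c_n)`, the product over all sites of the one-site solid harmonics of
degrees `c_n` is a nonzero member of `polyS N` with `𝔏`-eigenvalue `Σ_n c_n(c_n + d − 2)`. -/
theorem hasEigenvalue_polyLap_of_mem_labelSet (h2 : 2 ≤ Module.finrank ℝ E) {N : ℕ} {μ : ℝ}
    (hμ : μ ∈ labelSet Λ E N) : Module.End.HasEigenvalue (polyLap Λ E N) μ := by
  obtain ⟨k, hk, κs, rfl⟩ := mem_labelSet.1 hμ
  set i₀ : Fin (Module.finrank ℝ E) := ⟨0, by omega⟩
  set i₁ : Fin (Module.finrank ℝ E) := ⟨1, by omega⟩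
  have h01 : i₀ ≠ i₁ := by simp [i₀, i₁, Fin.ext_iff]
  set c : Λ → ℕ := fun n => (Finset.univ.filter fun j => (κs j).1 = n).card
  have hdeg : ∑ n ∈ Finset.univ, c n ≤ N := (sum_card_filter_eq κs).le.trans hk
  have hmem : harmonicProd (E := E) i₀ i₁ c Finset.univ ∈ polyS Λ E N :=
    polyS_mono hdeg (harmonicProd_mem i₀ i₁ c Finset.univ).1
  refine Module.End.hasEigenvalue_of_hasEigenvector (x := ⟨_, hmem⟩) ⟨?_, fun h0 => ?_⟩
  · rw [Module.End.mem_eigenspace_iff]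
    apply Subtype.ext
    funext x
    rw [polyLap_apply, Submodule.coe_smul, Pi.smul_apply, smul_eq_mul,
      sum_ambSiteLap_harmonicProd i₀ i₁ h01 c Finset.univ x, eigLabel]
    simp_rw [siteCount_eq_natCast κs]
    rfl
  · have := congrFun (congrArg Subtype.val h0) (fun _ => stdOrthonormalBasis ℝ E i₀)
    rw [Submodule.coe_zero, Pi.zero_apply] at this
    exact one_ne_zero ((harmonicProd_frame i₀ i₁ h01 c Finset.univ).symm.trans this)

/-- **THE SPECTRUM OF LÜSCHER'S OPERATOR ON `polyS N` IS EXACTLY THE LABEL SET** (`d ≥ 2`). -/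
theorem hasEigenvalue_polyLap_iff_mem_labelSet (h2 : 2 ≤ Module.finrank ℝ E) {N : ℕ} {μ : ℝ} :
    Module.End.HasEigenvalue (polyLap Λ E N) μ ↔ μ ∈ labelSet Λ E N :=
  ⟨fun h => mem_labelSet.2 (exists_eigLabel_of_hasEigenvalue h),
    hasEigenvalue_polyLap_of_mem_labelSet h2⟩

/-- **On the product of unit spheres**: every label has an eigenfunction of `−Σ_k ∂̃_k·∂̃_k` in
`polyS N` that does not vanish identically on `Ω` (`d ≥ 2`). -/
theorem exists_sphere_eigenfunction_of_mem_labelSet (h2 : 2 ≤ Module.finrank ℝ E) {N : ℕ} {μ : ℝ}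
    (hμ : μ ∈ labelSet Λ E N) :
    ∃ f ∈ polyS Λ E N, (∃ ξ : Λ → sphere (0 : E) 1, f (fun n => (ξ n : E)) ≠ 0) ∧
      ∀ ξ : Λ → sphere (0 : E) 1, -∑ k, siteLaplacian k f (fun n => (ξ n : E)) =
        μ * f (fun n => (ξ n : E)) := by
  obtain ⟨k, hk, κs, rfl⟩ := mem_labelSet.1 hμ
  set i₀ : Fin (Module.finrank ℝ E) := ⟨0, by omega⟩
  set i₁ : Fin (Module.finrank ℝ E) := ⟨1, by omega⟩
  have h01 : i₀ ≠ i₁ := by simp [i₀, i₁, Fin.ext_iff]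
  set c : Λ → ℕ := fun n => (Finset.univ.filter fun j => (κs j).1 = n).card
  have hdeg : ∑ n ∈ Finset.univ, c n ≤ N := (sum_card_filter_eq κs).le.trans hk
  have hmem : harmonicProd (E := E) i₀ i₁ c Finset.univ ∈ polyS Λ E N :=
    polyS_mono hdeg (harmonicProd_mem i₀ i₁ c Finset.univ).1
  have hb : (stdOrthonormalBasis ℝ E i₀ : E) ∈ sphere (0 : E) 1 := by simp
  refine ⟨harmonicProd i₀ i₁ c Finset.univ, hmem, ⟨fun _ => ⟨_, hb⟩, ?_⟩, fun ξ => ?_⟩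
  · rw [harmonicProd_frame i₀ i₁ h01 c Finset.univ]; exact one_ne_zero
  · have h := polyLap_apply_sphere (⟨harmonicProd i₀ i₁ c Finset.univ, hmem⟩ : polyS Λ E N) ξ
    rw [polyLap_apply] at h
    rw [← h, sum_ambSiteLap_harmonicProd i₀ i₁ h01 c Finset.univ, eigLabel]
    simp_rw [siteCount_eq_natCast κs]
    rfl

end Spectrum

end Summit.Ventures.LatticeQCDFlow.Exactness

end
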